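import Summits.CriticalPhenomena.PercolationContinuityZ3.Theorems.FK.SamePContinuationPinned
import Summits.CriticalPhenomena.PercolationContinuityZ3.Theorems.FK.ContinuityCruxDefs
import HarnessLib

/-!
# FK-continuity transplant, FO-11 (3e): the cell's crux C2 `FKContinuationPrinciple d q` from C1 — modulo the
# existence of the free box limit

Cell `fk-continuity` (bschramm), row FO-11; support file for the FK-continuity transplant
(`--supports stmt-CriticalPhenomena-4575`); builds on p205010 (kernel theorem, internal audit signed; external
expert review pending).  No named facts, no sorries, standard axioms.

Row FO-05's `FKContinuationPrinciple d q` (file `ContinuityCruxDefs.lean`: a sound FK history scheme robustly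
lawful at `(p, ε)` — `FKRobustLawful d q p ε N E`, Level C, pinned per-direction laws — with `ε < 2⁻³²`,
`0 < p < 1` forces `p_c(q) < p`) is `SameP.PinnedLawful.rcCriticalProb_lt` (file `SamePContinuationPinned.lean`)
once `E.minW`/`E.law`/`E.fresh` are unfolded to `SameP.pinnedW`/`pinnedLaw`/`freshOf` (definitional).  The one
remaining input is the existence, at every density, of a FREE box limit satisfying the `FKGibbs` sandwich
(rows FO-06b `isBoxLimit_rcLimit` and FO-06a-2 `IsBoxLimit.fkGibbs`), taken here as the hypothesis `hex`.

## References

* G. Kozma, S. Nitzan, arXiv:2401.12397 (2024), §1 p. 2 (approach 1), §4 p. 25. [KozmaNitzan2024]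
* G. Grimmett, *The Random-Cluster Model*, Springer 2006: Thm (2.43), Lemma (4.13)/(4.14)(b), Thm (4.19)(a), (5.2).
  [Grimmett2006]
-/

noncomputable section

namespace Summit.CriticalPhenomena.PercolationContinuityZ3.Theorems.FK

open MeasureTheory Literature.Probability.Percolation Literature.Probability.LatticeModels
open Literature.Barriers.CriticalPhenomena

variable {d : ℕ} {q : ℝ}

/-- **C2 from C1** (cell rows FO-05/FO-11): for `q ≥ 1`, if at every density in `[0,1]` a free box limit satisfying
the `FKGibbs` sandwich exists, then `FKContinuationPrinciple d q` holds — every sound FK history scheme robustly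
lawful at `(p, ε)` with `ε < 2⁻³²`, `0 < p < 1` forces `p_c(q) < p`.
[cite: KozmaNitzan2024, §1 p. 2 (approach 1), §4 p. 25] -/
theorem fkContinuationPrinciple_of_boxLimits (hq : 1 ≤ q)
    (hex : ∀ p' ∈ Set.Icc (0 : ℝ) 1, ∃ P : Measure (BondConfig (Site d)),
      FKGibbs d p' q P ∧ IsBoxLimit d false p' q P) :
    FKContinuationPrinciple d q := by
  intro p ε N E hR hε hp0 hp1 hS
  exact SameP.PinnedLawful.rcCriticalProb_lt (S := E.toHSiteScheme) (dirs := E.dirs) (reg := E.reg) (bad := E.bad)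
    ⟨hR.probes, hS.1, hR.cover, hR.lower, hR.determined, hR.freshCard, hR.fail⟩ hε ⟨hp0, hp1⟩ hq hS.2 hex

/-- **`FKContinuationZ3` from the existence input**, all `q ≥ 1` at once. [cite: KozmaNitzan2024, §1 p. 2 (approach 1)] -/
theorem fkContinuationZ3_of_boxLimits
    (hex : ∀ q : ℝ, 1 ≤ q → ∀ p' ∈ Set.Icc (0 : ℝ) 1, ∃ P : Measure (BondConfig (Site 3)),
      FKGibbs 3 p' q P ∧ IsBoxLimit 3 false p' q P) :
    FKContinuationZ3 := fun q hq =>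
  fkContinuationPrinciple_of_boxLimits hq (hex q hq)

end Summit.CriticalPhenomena.PercolationContinuityZ3.Theorems.FK

end
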